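import Summits.QuantumFields.YangMills.Theorems.UnitScaleTiltFluctuationComparisonRegPrRepAtHeightsSocket
import Summits.QuantumFields.YangMills.Theorems.AlphaInputsT3ACv2RecData
import Literature.MathematicalPhysics.QuantumFieldTheory.Balaban1983to89.T3AvgDivergenceSplit
import HarnessLib

/-!
# Route `UnitScaleTilt` — crux `FluctuationComparisonRegPrL` (stmt-QuantumFields-19935), v5h STUB 3′ `stub_alphaTwoRunOfLane`, conjunct (A)
# `RepAtHeights` FOR THE LANE'S DATUM `OfV2At.dataT3c`: everything but the two one-step rows discharged from the v2 (α) package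
# (support file `--supports stmt-QuantumFields-19935`; the stub stays open)

Fleet seat `ym-ust-19201-p2` (gen 3, socket pen); split card `CARD-19935-STUB3prime-split.md` (evidence #18 on the item), finding F-g3-1; socket theorem
`LogComparisonRepAtHeights.repAtHeights_of_oneStepTriv` (p501205) over the trivial-envelope schemas `T3AlphaInputsACTrivEnvelope` (p500692).
WHAT THIS FILE PROVES for `D := hAt.dataT3c hc γ hγ hγ1 π` (the (α) adapter's intended witness of STUB 3′, ★pub-balaban3d-alpha-1 p481907), CONDITIONAL on
the v2 package at given constants `hAt : AlphaInputsT3AC.OfV2At F 𝔠 a₀ a₁` only: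
* §1 level `0` of every run: `U_0(triv, W) = W` (`XT3.hU0`), `Pint_0 = 0` (`pintOfSeries` at `0`), `mainT_0(triv, W) = β_K·A(W)`, `Ecst K 0 = 0` — hence the
  base row `BaseTrivAt D 𝔠.b₀ 𝔠.p₀ K` ([Balaban1985UV3] (1) p.256: at `k = 0` both (41) and (47) are identities up to `e^{∓Rm_0}`, `Rm_0 ≥ 0`).
* §2 `TrivExpIntegrable D` from the data-regularity rows (`hU`/`hPm`/`hPb` below the top, `TerminalRowsT3` at the top; `mainT ≥ 0`).
* §3 `MainTermAtHeights D 𝔠.b₀ 𝔠.p₀ ε₀` under the adapter's thresholds (`θBal n ≤ a₁`, `B₃θBal n ≤ ε₀ ≤ a₀`, `4θBal n < ε₀`): below the cut-off it is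
  `dataT3c_mainTermIsAction` + `dataT3c_uminTriv` ([Balaban1985Variational] Thm 1); AT the cut-off (`n = K`, the interface gap F-α1-6) the fibre is the datum
  itself (`fibre_self`), which is printed-regular by `T3AvgDivergenceSplit.regPr_of_plaqSmall`, so `minActionRegPr_{K,K}(V) = A(V) = A(U_0(triv, V))`.
* §4 **`repAtHeights_dataT3c_of_oneStepRows`**: `OneStepLowerTrivAt D …` (∀ K, j < K) → `OneStepUpperTrivAt D …` (∀ K, j < K) → thresholds →
  `RepAtHeights D 𝔠.b₀ 𝔠.p₀ ε₀` — conjunct (A) of the stub for the lane's datum MODULO EXACTLY THE TWO ONE-STEP ROWS (lower = the reading of the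
  lane's residual `Fibre57LowAC`; upper = `Fibre49AC` at the trivial history + `HaarCompatT3 F`, finding F-g3-1).
Nothing of Bałaban's is asserted; standard axioms.

References: T. Bałaban, CMP 102 (1985) 255–275 [Balaban1985UV3] ((1)–(2) p.256, (41)–(42) p.266, (47) p.267); CMP 102 (1985) 277–309
[Balaban1985Variational] ((2), (6) p.278, Thm 1 (8) p.279); CMP 99 (1985) 75–102 [Balaban1985RegularSpaces] ((1.7)/(1.9) p.77).
-/

set_option autoImplicit false

noncomputable section

namespace Summit.QuantumFields.YangMills.Theorems

open MeasureTheory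
open Literature.MathematicalPhysics.QuantumFieldTheory.Balaban1983to89
open Literature.MathematicalPhysics.QuantumFieldTheory.Balaban1983to89.T3ContinuumYM3Torus
open Literature.MathematicalPhysics.QuantumFieldTheory.Balaban1983to89.T3UnitLawDensityEML (ℰp)
open Literature.MathematicalPhysics.QuantumFieldTheory.Balaban1983to89.T3UnitScaleTilt (θBal)
open Literature.MathematicalPhysics.QuantumFieldTheory.Balaban1983to89.T3ConstrainedMinimiser (fibre)
open Literature.MathematicalPhysics.QuantumFieldTheory.Balaban1983to89.T3LevelShift (fieldShift fieldShift_refl wilsonAction4_fieldShift)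
open Literature.MathematicalPhysics.QuantumFieldTheory.Balaban1983to89.T3DescentFibreTower (fibre_self)
open Literature.MathematicalPhysics.QuantumFieldTheory.Balaban1983to89.T3PrintedRegularMinimiser
open Literature.MathematicalPhysics.QuantumFieldTheory.Balaban1983to89.T3RegularMinimiser (regFibre regThreshold)
open Literature.MathematicalPhysics.QuantumFieldTheory.Balaban1983to89.T3AvgDivergenceSplit (regPr_of_plaqSmall)
open Literature.MathematicalPhysics.QuantumFieldTheory.Balaban1983to89.T3AlphaInputsAC
open Literature.MathematicalPhysics.QuantumFieldTheory.Balaban1983to89.T3AlphaInputsACTrivEnvelope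
open Literature.MathematicalPhysics.QuantumFieldTheory.Balaban1983to89.Missing (boltzmann)
open Literature.MathematicalPhysics.QuantumFieldTheory.Balaban1985CMP102
open Literature.MathematicalPhysics.QuantumFieldTheory.Balaban1985CMP102.Setting
open Summit.QuantumFields.Balaban3D.Carriers
open Summit.QuantumFields.Balaban3D.Proofs.Primitives
open Summit.QuantumFields.Balaban3D.Proofs.TowerAC
open Summit.QuantumFields.Balaban3D.Proofs.StandardAC
open Summit.QuantumFields.Balaban3D.Proofs.InputsAC
open Summit.QuantumFields.Balaban3D.Proofs.TowerFactsAC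
open Summit.QuantumFields.Balaban3D.Proofs (Bound55Std.measurable_actionEta Bound55Std.actionEta_nonneg)
open Summit.QuantumFields.YangMills.Theorems.LogComparisonRepAtHeights

variable {F : T3Family} {𝔠 : AlphaConsts F.L (suGroupModel 2).N} {a₀ a₁ : ℝ}
  (h : AlphaInputsT3AC.OfV2At F 𝔠 a₀ a₁) (hc : 0 < a₀ ∧ 0 < a₁ ∧ 𝔠.B₃ * a₁ ≤ a₀) (γ : ℝ) (hγ : 0 < γ)
  (hγ1 : γ ≤ (min 𝔠.gamma0 1) ^ 2) (π : AlphaInputsT3AC.PolymerT3 F)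

/-! ## §1 Level `0` of every run and the base row -/

/-- `U_0(triv, W) = W` for the datum (the package's `hU0`). [cite: Balaban1985UV3, (1) p.256] -/
theorem AlphaInputsT3AC.OfV2At.dataT3c_umin_zero (K : ℕ) (W : GaugeField (F.P K) 0 (Matrix.specialUnitaryGroup (Fin 2) ℂ)) :
    (h.dataT3c hc γ hγ hγ1 π).Umin K 0 ((h.dataT3c hc γ hγ hγ1 π).triv K 0) W = W :=
  (h.pkgAtV2 hc γ hγ hγ1 K).hU0 W

/-- `Pint_0 ≡ 0` for the datum (`pintOfSeries` at level `0`: no interaction terms in `ρ₀`, (1)). [cite: Balaban1985UV3, (1) p.256] -/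
theorem AlphaInputsT3AC.OfV2At.dataT3c_pint_zero (K : ℕ) (hh : (h.dataT3c hc γ hγ hγ1 π).Hist K 0)
    (W : GaugeField (F.P K) 0 (Matrix.specialUnitaryGroup (Fin 2) ℂ)) :
    (h.dataT3c hc γ hγ hγ1 π).Pint K 0 hh W = 0 :=
  rfl

/-- `mainT_0(triv, W) = β_K·A(W)` for the datum (`MainTermIsAction` + `U_0 = id`). [cite: Balaban1985UV3, (1) p.256 and (5) p.256] -/
theorem AlphaInputsT3AC.OfV2At.dataT3c_mainT_triv_zero (K : ℕ) (W : GaugeField (F.P K) 0 (Matrix.specialUnitaryGroup (Fin 2) ℂ)) :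
    (h.dataT3c hc γ hγ hγ1 π).mainT K 0 ((h.dataT3c hc γ hγ hγ1 π).triv K 0) W = (F.scheme ℰp γ).β K * wilsonAction4 W := by
  rw [h.dataT3c_mainTermIsAction hc γ hγ hγ1 π K 0 _ W, h.dataT3c_umin_zero hc γ hγ hγ1 π K W]

/-- `Ecst K 0 = 0` for the datum (route normalisation `E_0 − E = 0`). [cite: Balaban1985UV3, (62) p.271 and (64) p.273] -/
theorem AlphaInputsT3AC.OfV2At.dataT3c_Ecst_zero (K : ℕ) : (h.dataT3c hc γ hγ hγ1 π).Ecst K 0 = 0 := by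
  rw [h.dataT3c_Ecst_eq hc γ hγ hγ1 π K 0 (Nat.zero_le K), Finset.range_zero, Finset.sum_empty, neg_zero]

/-- **THE BASE ROW `BaseTrivAt` FOR THE DATUM** at every cut-off: on the finest window (indeed everywhere), `e^{−Rm_0}·e^{−β_K A} ≤ e^{−β_K A} ≤
e^{+Rm_0}·e^{−β_K A}` (`Rm_0 ≥ 0`). [cite: Balaban1985UV3, (1) p.256] -/
theorem AlphaInputsT3AC.OfV2At.dataT3c_baseTrivAt (K : ℕ) : BaseTrivAt (h.dataT3c hc γ hγ hγ1 π) 𝔠.b₀ 𝔠.p₀ K := by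
  refine ae_of_all _ fun W _ => ?_
  have hR : 0 ≤ (h.dataT3c hc γ hγ hγ1 π).Rm K 0 := Rm_nonneg (h.dataT3c_rmSize hc γ hγ hγ1 π) (Nat.zero_le K)
  rw [lowerTriv_eq_exp, upperTriv_eq_exp, h.dataT3c_mainT_triv_zero hc γ hγ hγ1 π K W, h.dataT3c_pint_zero hc γ hγ hγ1 π K _ W,
    h.dataT3c_Ecst_zero hc γ hγ hγ1 π K]
  unfold boltzmann
  constructor
  · apply Real.exp_le_exp.mpr
    linarith
  · apply Real.exp_le_exp.mpr
    linarith

/-! ## §2 Integrability of the trivial exponentials -/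

/-- **`TrivExpIntegrable` FOR THE DATUM**: `e^{−mainT_j(triv) + Pint_j(triv)}` is integrable at every level `j ≤ K` — measurable (`hU`, `hPm`, resp. the
terminal rows) and bounded by `e^{cP}` (`mainT ≥ 0`, `Pint ≤ cP`). [cite: Balaban1985UV3, (41) p.266] -/
theorem AlphaInputsT3AC.OfV2At.dataT3c_trivExpIntegrable : TrivExpIntegrable (h.dataT3c hc γ hγ hγ1 π) := by
  intro K j hj
  have key : ∀ (hU : Measurable ((h.pkgAtV2 hc γ hγ hγ1 K).UkH j (Hist.triv (F.P K) j)))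
      (hPm : Measurable ((inputOfAC 𝔠.lane (h.pkgAtV2 hc γ hγ hγ1 K).X (h.pkgAtV2 hc γ hγ hγ1 K).𝔖).Pint j (Hist.triv (F.P K) j)))
      (cP : ℝ) (hPb : ∀ U : GaugeField (F.P K) j (Matrix.specialUnitaryGroup (Fin 2) ℂ),
        (inputOfAC 𝔠.lane (h.pkgAtV2 hc γ hγ hγ1 K).X (h.pkgAtV2 hc γ hγ hγ1 K).𝔖).Pint j (Hist.triv (F.P K) j) U ≤ cP),
      Integrable (expTriv (h.dataT3c hc γ hγ hγ1 π) K j) (fieldMeasure (F.P K) j (Matrix.specialUnitaryGroup (Fin 2) ℂ)) := by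
    intro hU hPm cP hPb
    show Integrable (fun W => Real.exp (-((h.pkgAtV2 hc γ hγ hγ1 K).T.mainT j (Hist.triv (F.P K) j) W) +
      (h.pkgAtV2 hc γ hγ hγ1 K).T.Pint j (Hist.triv (F.P K) j) W)) _
    have hmain : ∀ W : GaugeField (F.P K) j (Matrix.specialUnitaryGroup (Fin 2) ℂ),
        (h.pkgAtV2 hc γ hγ hγ1 K).T.mainT j (Hist.triv (F.P K) j) W =
          ((T3Scales F γ hγ (hγ1.trans (sq_min_one_le _ 𝔠.gamma0_pos)) K).gk j)⁻¹ ^ 2 *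
            (T3Scales F γ hγ (hγ1.trans (sq_min_one_le _ 𝔠.gamma0_pos)) K).actionEta j
              ((h.pkgAtV2 hc γ hγ hγ1 K).UkH j (Hist.triv (F.P K) j) W) := fun _ => rfl
    have h1 := Balaban3D.Proofs.Transport48.integrable_weight_mul_exp (P := F.P K) (G := Matrix.specialUnitaryGroup (Fin 2) ℂ)
      (m := fun _ => (1 : ℝ)) measurable_const (fun _ => zero_le_one) (fun _ => le_rfl)
      (F := fun W => -((h.pkgAtV2 hc γ hγ hγ1 K).T.mainT j (Hist.triv (F.P K) j) W) +
        (h.pkgAtV2 hc γ hγ hγ1 K).T.Pint j (Hist.triv (F.P K) j) W) ?_ (c := cP) ?_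
    · exact h1.congr (ae_of_all _ fun W => one_mul _)
    · simp_rw [hmain]
      exact (measurable_const.mul ((Bound55Std.measurable_actionEta
        (S := T3Scales F γ hγ (hγ1.trans (sq_min_one_le _ 𝔠.gamma0_pos)) K) j).comp hU)).neg.add hPm
    · intro W
      have h0 : 0 ≤ (h.pkgAtV2 hc γ hγ hγ1 K).T.mainT j (Hist.triv (F.P K) j) W := by
        rw [hmain]
        exact mul_nonneg (sq_nonneg _) (Bound55Std.actionEta_nonneg (S := T3Scales F γ hγ (hγ1.trans (sq_min_one_le _ 𝔠.gamma0_pos)) K) j _)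
      have h2 : (h.pkgAtV2 hc γ hγ hγ1 K).T.Pint j (Hist.triv (F.P K) j) W ≤ cP := hPb W
      linarith
  rcases Nat.lt_or_eq_of_le hj with hlt | heq
  · have st := (h.pkgAtV2 hc γ hγ hγ1 K).run.steps j hlt
    exact key (st.hU _) (st.hPm _) _ (st.hPb _)
  · subst heq
    exact key ((h.pkgAtV2 hc γ hγ hγ1 j).terminal_measurable_UkH _) ((h.pkgAtV2 hc γ hγ hγ1 j).terminal_measurable_Pint _) _
      ((h.pkgAtV2 hc γ hγ hγ1 j).terminal_Pint_le _)

/-! ## §3 The main term at the heights, including the cut-off height `n = K` -/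

/-- At the cut-off height the composite minimiser at the trivial history, read through the (trivial) level identification, IS the datum:
`U_{K−K}(triv, fieldShift V) = V` (index bookkeeping over `K − K = 0` + `hU0`). [cite: Balaban1985UV3, (1) p.256] -/
theorem AlphaInputsT3AC.OfV2At.dataT3c_umin_sub_self (K : ℕ) (V : GaugeField (F.P K) 0 (Matrix.specialUnitaryGroup (Fin 2) ℂ))
    (e : (F.PP F.m K).sitesPerDir (K - K) = (F.PP F.m K).sitesPerDir 0) :
    (h.dataT3c hc γ hγ hγ1 π).Umin K (K - K) ((h.dataT3c hc γ hγ hγ1 π).triv K (K - K)) (fieldShift e V) = V := by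
  have aux : ∀ (j : ℕ) (hj : j = 0) (e' : (F.PP F.m K).sitesPerDir j = (F.PP F.m K).sitesPerDir 0),
      (h.dataT3c hc γ hγ hγ1 π).Umin K j ((h.dataT3c hc γ hγ hγ1 π).triv K j) (fieldShift e' V) = V := by
    intro j hj e'
    subst hj
    rw [fieldShift_refl]
    exact h.dataT3c_umin_zero hc γ hγ hγ1 π K V
  exact aux (K - K) (Nat.sub_self K) e

/-- At the cut-off height print's regular fibre of a `θBal(K)`-small datum is the datum alone and `minActionRegPr_{K,K}(ε₀)(V) = A(V)`, provided
`4·θBal(K) < ε₀` (plaquette smallness ⇒ both clauses of [Balaban1985Variational] (2), `regPr_of_plaqSmall`; `fibre_self`). [cite: Balaban1985Variational, (2) p.278 and (6) p.278] -/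
theorem minActionRegPr_self_of_plaqSmall {K : ℕ} (hK : K ≤ K) {ε₀ : ℝ} (hε : 0 < ε₀)
    (V : GaugeField (F.P K) 0 (Matrix.specialUnitaryGroup (Fin 2) ℂ)) {δ : ℝ} (hV : PlaqSmall δ V) (h4 : 4 * δ < ε₀) :
    minActionRegPr F K K hK ε₀ V = wilsonAction4 V := by
  have hδε : δ ≤ ε₀ := by linarith
  have hreg : RegPr F K K ε₀ V := by
    refine regPr_of_plaqSmall F hV ?_ ?_
    · unfold regThreshold
      rw [Nat.sub_self, mul_zero, pow_zero, mul_one]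
      exact hδε
    · rw [Nat.sub_self, mul_zero, pow_zero, mul_one]
      exact h4
  have hfib : regFibrePr F K K hK ε₀ V = {V} := by
    apply Set.eq_singleton_iff_unique_mem.mpr
    refine ⟨⟨⟨?_, hreg.1⟩, hreg.2⟩, fun U hU => ?_⟩
    · show V ∈ fibre F ℰp K K hK V
      rw [fibre_self]
      exact Set.mem_singleton V
    · have hU1 : U ∈ fibre F ℰp K K hK V := hU.1.1
      rw [fibre_self] at hU1
      exact hU1
  unfold minActionRegPr
  rw [hfib, Set.image_singleton, csInf_singleton]

/-- **`MainTermAtHeights` FOR THE DATUM** under the adapter's thresholds: for `n < K` by [Balaban1985Variational] Thm 1 on `U_{K−n}(triv, ·)` (rows r1 via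
`dataT3c_uminTriv`) and `MainTermIsAction`; for `n = K` by §3's bookkeeping. [cite: Balaban1985UV3, (42) p.266; Balaban1985Variational, Thm 1 (8) p.279] -/
theorem AlphaInputsT3AC.OfV2At.dataT3c_mainTermAtHeights (ε₀ : ℝ) (hε : 0 < ε₀) (hhi : ε₀ ≤ a₀)
    (ha₁ : ∀ n, θBal F.L γ 𝔠.b₀ 𝔠.p₀ n ≤ a₁) (hlo : ∀ n, 𝔠.B₃ * θBal F.L γ 𝔠.b₀ 𝔠.p₀ n ≤ ε₀)
    (h4 : ∀ n, 4 * θBal F.L γ 𝔠.b₀ 𝔠.p₀ n < ε₀) :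
    MainTermAtHeights (h.dataT3c hc γ hγ hγ1 π) 𝔠.b₀ 𝔠.p₀ ε₀ := by
  intro K n hn V hV
  rw [h.dataT3c_mainTermIsAction hc γ hγ hγ1 π]
  congr 1
  rcases Nat.lt_or_eq_of_le hn with hlt | heq
  · exact (h.dataT3c_uminTriv hc γ hγ hγ1 π K n hlt ε₀ (ha₁ n) (hlo n) hhi V hV).2
  · subst heq
    rw [h.dataT3c_umin_sub_self hc γ hγ hγ1 π n V]
    exact (minActionRegPr_self_of_plaqSmall (F := F) hn hε V hV (h4 n)).symm

/-! ## §4 Conjunct (A) for the datum, modulo the two one-step rows -/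

/-- **`RepAtHeights` FOR THE LANE'S DATUM FROM THE TWO ONE-STEP TRIVIAL ENVELOPES** (conjunct (A) of v5h STUB 3′ at the intended witness
`D = OfV2At.dataT3c`, everything else discharged from the v2 package): given, for every run `K` and step `j < K`, the lower one-step envelope
`OneStepLowerTrivAt D 𝔠.b₀ 𝔠.p₀ K j` (the reading of the lane's residual `Fibre57LowAC`) and the MASS-FREE upper one `OneStepUpperTrivAt D 𝔠.b₀ 𝔠.p₀ K j`
(`Fibre49AC` at the trivial history + exact Haar compatibility `HaarCompatT3 F`, finding F-g3-1), and the adapter's thresholds on the coupling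
(`θBal n ≤ a₁`, `B₃θBal n ≤ ε₀ ≤ a₀`, `4θBal n < ε₀` — all from `γ ≤ γ₁(ε₀)`, `T3Thresholds`), the datum carries [Balaban1985UV3] (41) ∧ (47) at the
trivial history for the RESTRICTED height densities, two-sided with slack `Rm`: `RepAtHeights D 𝔠.b₀ 𝔠.p₀ ε₀`.
[cite: Balaban1985UV3, (41) p.266 and (47) p.267; Balaban1985Variational, Thm 1 (8) p.279] -/
theorem AlphaInputsT3AC.OfV2At.repAtHeights_dataT3c_of_oneStepRows (ε₀ : ℝ) (hε : 0 < ε₀) (hhi : ε₀ ≤ a₀)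
    (ha₁ : ∀ n, θBal F.L γ 𝔠.b₀ 𝔠.p₀ n ≤ a₁) (hlo : ∀ n, 𝔠.B₃ * θBal F.L γ 𝔠.b₀ 𝔠.p₀ n ≤ ε₀)
    (h4 : ∀ n, 4 * θBal F.L γ 𝔠.b₀ 𝔠.p₀ n < ε₀)
    (hlow : ∀ (K j : ℕ) (hjK : j + 1 ≤ K), OneStepLowerTrivAt (h.dataT3c hc γ hγ hγ1 π) 𝔠.b₀ 𝔠.p₀ K j hjK)
    (hup : ∀ (K j : ℕ) (hjK : j + 1 ≤ K), OneStepUpperTrivAt (h.dataT3c hc γ hγ hγ1 π) 𝔠.b₀ 𝔠.p₀ K j hjK) :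
    RepAtHeights (h.dataT3c hc γ hγ hγ1 π) 𝔠.b₀ 𝔠.p₀ ε₀ :=
  repAtHeights_of_oneStepTriv hγ.le
    ⟨h.dataT3c_baseTrivAt hc γ hγ hγ1 π, fun K j hjK => ⟨hlow K j hjK, hup K j hjK⟩, h.dataT3c_trivExpIntegrable hc γ hγ hγ1 π⟩
    (h.dataT3c_mainTermAtHeights hc γ hγ hγ1 π ε₀ hε hhi ha₁ hlo h4) (h.dataT3c_rmSize hc γ hγ hγ1 π)

end Summit.QuantumFields.YangMills.Theorems

end
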